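import Summits.NavierStokesRegularity.FluidComputer.ClayBlowupLocalAxisymTypeI
import Summits.NavierStokesRegularity.FluidComputer.ClayBlowupOfBreakdown
import HarnessLib

/-!
# EVERY AXISYMMETRIC BREAKDOWN SCENARIO FOR FEFFERMAN'S (C) IS TYPE II — the (C)-reading of the K8 row
# with the Clay force

Cell `ns-blowup`, seat `ns-blowup-ecbridge-2` (g12; the E–C endpoint theory seat). LABEL: E–C typing
(KERNEL — no named fact, no new definition, no conjecture hypothesis). WHAT THIS IS NOT: not
Navier–Stokes evidence — a necessary condition on any hypothetical axisymmetric witness of Fefferman's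
(C); no witness is claimed. Companion memo: `run/shared/lean/pub/ns-blowup/ecbridge2/ECBRIDGE-2-MEMO-11.md`.

## Content

By `ClayEvolution.exists_claySolution_or_clayBlowup` (g5), a Clay datum `u₀` and a Clay force `f`
(smooth on `[0, ∞) × ℝ³`, decay (5)) WITHOUT a global Clay-class solution generate a `ClayBlowup ν`
with datum `u₀` and force `f` — their maximal finite-energy classical evolution. If `u₀` and `f` are
AXISYMMETRIC, g12's `not_typeI_of_isAxisymmetric_clayForce` and `not_localTypeI_of_isAxisymmetric_forced`
apply:

* `ClayBlowup.exists_cylRadius_mul_norm_le_of_localTypeI` — KNSS Thm 6.2's main step with force at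
  EVERY viscosity (Type I in time on a ball ⇒ `|x'|‖u‖` bounded on a smaller ball);
* `ClayBlowup.axisymmetric_singularPoint_portrait` — one name for the axisymmetric local rows at a
  singular point (on the axis; `r‖u‖` locally unbounded; no local Type-I bound; Type-II growth);
  `ClayBlowup.frequently_gt_typeI_of_isAxisymmetric` — `limsup_{t↑T} √(T−t)‖u(t)‖_∞ = ∞` in filter form;
* `ClayEvolution.axisymmetric_breakdown_typeII` — the evolution is NOT of Type I (`¬ IsTypeIBlowup`),
  its singular points lie on the axis, and at each of them NO bound `‖u(t,x)‖ ≤ C/√(T − t)` holds for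
  `t` near `T` on any ball — UNCONDITIONALLY (Koch–Nadirashvili–Seregin–Šverák 2009 Thm 6.2 /
  Seregin–Šverák 2009 Thm 1.1, here for the FORCED Cauchy problem with Clay data, a statement not in
  print — KILLSHEET gap G-F1).

References: Koch–Nadirashvili–Seregin–Šverák, Acta Math. 203 (2009), Thm 6.2
[cite: KochNadirashviliSereginSverak2009, Thm 6.2]; Seregin–Šverák, Comm. PDE 34 (2009), Thm 1.1
[cite: SereginSverak2009, Thm 1.1]; C. L. Fefferman, (C) [cite: FeffermanClay2006, (C)].
-/

noncomputable section

namespace Summit.NavierStokesRegularity.FluidComputer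

open Set MeasureTheory Filter Topology Function Metric
open scoped ENNReal NNReal ContDiff
open Literature.Analysis Literature.Analysis.FluidPDE
open Summit.NavierStokesRegularity.NavierStokesRegularity

/-- **KNSS THM 6.2's MAIN STEP WITH THE CLAY FORCE, EVERY VISCOSITY**: for a Clay blow-up with
axisymmetric datum and Clay force and an axis point `x₁`, a local Type-I bound
`‖u(t, x)‖ ≤ C/√(T − t)` on `(t₀, T) × B(x₁, r₀)` (`r₀ ≤ 2`, `C > 0`) forces `|x'|‖u‖ ≤ C'` on
`((t₀ + T)/2, T) × B(x₁, r₀/4)` (viscosity normalisation of `exists_cylRadius_mul_norm_le_of_localTypeI_one`;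
`|x'|‖u‖` is invariant under the rescaling up to the factor `ν`).
[cite: KochNadirashviliSereginSverak2009, proof of Thm 6.2 (arXiv pp. 12–13)] -/
theorem ClayBlowup.exists_cylRadius_mul_norm_le_of_localTypeI {ν : ℝ} (X : ClayBlowup ν) (hν : 0 < ν)
    (h0A : IsAxisymmetric (X.u 0)) (hfA : ∀ t ∈ Ico 0 X.T, IsAxisymmetric (X.f t))
    {x₁ : EuclideanSpace ℝ (Fin 3)} (hx₁ : cylRadius x₁ = 0) {r₀ t₀ C : ℝ} (hr₀ : 0 < r₀)
    (hr₀2 : r₀ ≤ 2) (ht₀ : t₀ ∈ Ico 0 X.T) (hC : 0 < C)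
    (hI : ∀ t ∈ Ioo t₀ X.T, ∀ x ∈ ball x₁ r₀, ‖X.u t x‖ ≤ C / Real.sqrt (X.T - t)) :
    ∃ C' : ℝ, ∀ t ∈ Ioo ((t₀ + X.T) / 2) X.T, ∀ x ∈ ball x₁ (r₀ / 4),
      cylRadius x * ‖X.u t x‖ ≤ C' := by
  have hax : ∀ t ∈ Ico 0 X.T, IsAxisymmetric (X.u t) := X.isAxisymmetric hν h0A hfA
  set a : ℝ := 1 / ν with ha
  have ha0 : 0 < a := by positivity
  set Y : ClayBlowup 1 := X.rescale hν one_pos with hY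
  have hYu : ∀ s z, Y.u s z = a • X.u (a * s) z := fun s z => X.rescale_u_apply hν one_pos s z
  have hYT : Y.T = X.T / a := X.rescale_T hν one_pos
  have hmaps : ∀ {s : ℝ} {lo : ℝ}, s ∈ Ioo (lo / a) Y.T → a * s ∈ Ioo lo X.T := by
    intro s lo hs
    rw [hYT] at hs
    constructor
    · have := mul_lt_mul_of_pos_left hs.1 ha0; rwa [mul_div_cancel₀ _ ha0.ne'] at this
    · have := mul_lt_mul_of_pos_left hs.2 ha0; rwa [mul_div_cancel₀ _ ha0.ne'] at this
  have haxY : ∀ s ∈ Ico 0 Y.T, IsAxisymmetric (Y.u s) := by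
    intro s hs
    rw [hYT] at hs
    have hm : a * s ∈ Ico 0 X.T := by
      refine ⟨mul_nonneg ha0.le hs.1, ?_⟩
      have := mul_lt_mul_of_pos_left hs.2 ha0; rwa [mul_div_cancel₀ _ ha0.ne'] at this
    have e : Y.u s = fun z => a • X.u (a * s) z := funext fun z => hYu s z
    rw [e]; exact (hax _ hm).const_smul a
  have ht₀Y : t₀ / a ∈ Ico 0 Y.T := by
    rw [hYT]; exact ⟨div_nonneg ht₀.1 ha0.le, div_lt_div_of_pos_right ht₀.2 ha0⟩
  -- the Type-I bound for `Y` with constant `√a · C`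
  have hIY : ∀ s ∈ Ioo (t₀ / a) Y.T, ∀ x ∈ ball x₁ r₀,
      ‖Y.u s x‖ ≤ Real.sqrt a * C / Real.sqrt (Y.T - s) := by
    intro s hs x hx
    have hs' := hmaps hs
    have h := hI (a * s) hs' x hx
    rw [hYu, norm_smul, Real.norm_of_nonneg ha0.le, hYT]
    have hpos : 0 < X.T / a - s := by rw [hYT] at hs; linarith [hs.2]
    have e1 : X.T - a * s = a * (X.T / a - s) := by field_simp
    rw [e1, Real.sqrt_mul ha0.le] at h
    calc a * ‖X.u (a * s) x‖ ≤ a * (C / (Real.sqrt a * Real.sqrt (X.T / a - s))) :=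
          mul_le_mul_of_nonneg_left h ha0.le
      _ = Real.sqrt a * C / Real.sqrt (X.T / a - s) := by
          rw [← mul_div_assoc, ← div_mul_div_comm, Real.div_sqrt, mul_div_assoc]
  obtain ⟨C', hC'⟩ := Y.exists_cylRadius_mul_norm_le_of_localTypeI_one haxY hx₁ hr₀ hr₀2 ht₀Y
    (by positivity) hIY
  refine ⟨a⁻¹ * C', fun t ht x hx => ?_⟩
  have hs : t / a ∈ Ioo ((t₀ / a + Y.T) / 2) Y.T := by
    rw [hYT]
    constructor
    · rw [show (t₀ / a + X.T / a) / 2 = ((t₀ + X.T) / 2) / a by ring]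
      exact div_lt_div_of_pos_right ht.1 ha0
    · exact div_lt_div_of_pos_right ht.2 ha0
  have h := hC' (t / a) hs x hx
  rw [hYu, mul_div_cancel₀ _ ha0.ne', norm_smul, Real.norm_of_nonneg ha0.le] at h
  calc cylRadius x * ‖X.u t x‖ = a⁻¹ * (cylRadius x * (a * ‖X.u t x‖)) := by field_simp
    _ ≤ a⁻¹ * C' := mul_le_mul_of_nonneg_left h (inv_pos.2 ha0).le

/-- **THE PORTRAIT OF A SINGULAR POINT OF AN AXISYMMETRIC CLAY BLOW-UP, WITH THE FORCE** (`ν > 0`,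
axisymmetric datum and Clay force; no named fact, no conjecture): at a point `x₁` which is not
backward bounded at `T` — (0) `x₁` lies on the axis; (1) `r‖u‖` is unbounded in every
`(t₀, T) × B(x₁, r₀)` (local KNSS 6.1, g11); (2) NO local Type-I bound `‖u(t,x)‖ ≤ C/√(T − t)` for
`t` near `T` on any `B(x₁, r₀)` (local KNSS 6.2, g12); (3) Type-II growth inside every ball. One name
for the axisymmetric rows of the census. [cite: KochNadirashviliSereginSverak2009, Thms 6.1–6.2]
[cite: SereginSverak2009, Thms 1.1–1.2] -/
theorem ClayBlowup.axisymmetric_singularPoint_portrait {ν : ℝ} (X : ClayBlowup ν) (hν : 0 < ν)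
    (h0A : IsAxisymmetric (X.u 0)) (hfA : ∀ t ∈ Ico 0 X.T, IsAxisymmetric (X.f t))
    {x₁ : EuclideanSpace ℝ (Fin 3)} (hx₁ : ¬ IsBackwardBoundedAt X.u X.T x₁) :
    cylRadius x₁ = 0 ∧
    (∀ r₀ : ℝ, 0 < r₀ → ∀ t₀ : ℝ, t₀ < X.T → ∀ C : ℝ,
      ∃ t ∈ Ioo t₀ X.T, ∃ x ∈ ball x₁ r₀, C < cylRadius x * ‖X.u t x‖) ∧
    (∀ r₀ : ℝ, 0 < r₀ → ∀ C : ℝ,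
      ¬ ∀ᶠ t in 𝓝[<] X.T, ∀ x ∈ ball x₁ r₀, ‖X.u t x‖ ≤ C / Real.sqrt (X.T - t)) ∧
    (∀ r₀ : ℝ, 0 < r₀ → ∀ C : ℝ, ∀ t₀ : ℝ, t₀ < X.T →
      ∃ t ∈ Ioo t₀ X.T, ∃ x ∈ ball x₁ r₀, C / Real.sqrt (X.T - t) < ‖X.u t x‖) :=
  ⟨X.cylRadius_eq_zero_of_not_isBackwardBoundedAt hν h0A hfA hx₁,
    fun _ hr₀ _ ht₀ C => X.exists_local_cylRadius_mul_norm_gt hν h0A hfA hx₁ hr₀ ht₀ C,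
    fun _ hr₀ C => X.not_localTypeI_of_isAxisymmetric_forced hν h0A hfA hx₁ hr₀ C,
    fun _ hr₀ C _ ht₀ => X.exists_gt_typeI_near_of_isAxisymmetric hν h0A hfA hx₁ hr₀ C ht₀⟩

/-- **EVERY AXISYMMETRIC BREAKDOWN SCENARIO FOR (C) IS TYPE II, UNCONDITIONALLY** (`ν > 0`; no named
fact, no conjecture): let `u₀` be an axisymmetric Clay datum (smooth, divergence free, rapid decay) and
`f` an axisymmetric Clay force (smooth on `[0, ∞) × ℝ³`, rapid space–time decay) which admit NO global
Clay-class solution. Then their maximal finite-energy classical evolution is a Clay blow-up `B` with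
`B.u 0 = u₀`, `B.f = f`, which is NOT Type I (`¬ IsTypeIBlowup B.u B.T`), and which has a singular point;
every singular point lies on the axis, and around it NO local Type-I bound `‖u(t,x)‖ ≤ C/√(T − t)`
(`t` near `T`, `x ∈ B(x₁, r₀)`) holds. [cite: KochNadirashviliSereginSverak2009, Thm 6.2]
[cite: SereginSverak2009, Thm 1.1] [cite: FeffermanClay2006, (C)] -/
theorem ClayEvolution.axisymmetric_breakdown_typeII {ν : ℝ} (hν : 0 < ν)
    {u₀ : EuclideanSpace ℝ (Fin 3) → EuclideanSpace ℝ (Fin 3)}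
    {f : ℝ → EuclideanSpace ℝ (Fin 3) → EuclideanSpace ℝ (Fin 3)}
    (hu₀ : ContDiff ℝ ∞ u₀) (hdiv : NSWave0.IsDivFree u₀) (hdec : HasRapidSpatialDecay u₀)
    (hs : IsSmoothOnHalfSpace f) (hd : HasRapidSpaceTimeDecay f)
    (h0A : IsAxisymmetric u₀) (hfA : ∀ t, 0 ≤ t → IsAxisymmetric (f t))
    (hno : ¬ ∃ (u : ℝ → EuclideanSpace ℝ (Fin 3) → EuclideanSpace ℝ (Fin 3))
        (p : ℝ → EuclideanSpace ℝ (Fin 3) → ℝ),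
        IsSmoothOnHalfSpace u ∧ IsSmoothOnHalfSpace p ∧
          IsNavierStokesSolution ν f u₀ u p ∧ HasBoundedEnergy u) :
    ∃ B : ClayBlowup ν, B.u 0 = u₀ ∧ B.f = f ∧ ¬ IsTypeIBlowup B.u B.T ∧
      (∃ x₁ : EuclideanSpace ℝ (Fin 3), ¬ IsBackwardBoundedAt B.u B.T x₁) ∧
      ∀ x₁ : EuclideanSpace ℝ (Fin 3), ¬ IsBackwardBoundedAt B.u B.T x₁ →
        cylRadius x₁ = 0 ∧ ∀ r₀ : ℝ, 0 < r₀ → ∀ C : ℝ,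
          ¬ ∀ᶠ t in 𝓝[<] B.T, ∀ x ∈ ball x₁ r₀, ‖B.u t x‖ ≤ C / Real.sqrt (B.T - t) := by
  rcases ClayEvolution.exists_claySolution_or_clayBlowup hν hu₀ hdiv hdec hs hd with hsol | ⟨B, hB0, hBf⟩
  · exact absurd hsol hno
  have h0A' : IsAxisymmetric (B.u 0) := by rw [hB0]; exact h0A
  have hfA' : ∀ t ∈ Ico 0 B.T, IsAxisymmetric (B.f t) := fun t ht => by rw [hBf]; exact hfA t ht.1
  refine ⟨B, hB0, hBf, B.not_typeI_of_isAxisymmetric_clayForce hν h0A' hfA',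
    B.exists_not_isBackwardBoundedAt hν, fun x₁ hx₁ => ⟨?_, fun r₀ hr₀ C => ?_⟩⟩
  · exact B.cylRadius_eq_zero_of_not_isBackwardBoundedAt hν h0A' hfA' hx₁
  · exact B.not_localTypeI_of_isAxisymmetric_forced hν h0A' hfA' hx₁ hr₀ C


/-- **The Type-II rate in filter form** (`ν > 0`, axisymmetric datum and Clay force): for every `C`,
frequently as `t ↑ T` some point has `‖u(t, x)‖ > C/√(T − t)`, i.e.
`limsup_{t↑T} √(T − t)‖u(t)‖_∞ = ∞`. [cite: KochNadirashviliSereginSverak2009, Thm 6.2] -/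
theorem ClayBlowup.frequently_gt_typeI_of_isAxisymmetric {ν : ℝ} (X : ClayBlowup ν) (hν : 0 < ν)
    (h0A : IsAxisymmetric (X.u 0)) (hfA : ∀ t ∈ Ico 0 X.T, IsAxisymmetric (X.f t)) (C : ℝ) :
    ∃ᶠ t in 𝓝[<] X.T, ∃ x : EuclideanSpace ℝ (Fin 3), C / Real.sqrt (X.T - t) < ‖X.u t x‖ := by
  have h := X.not_typeI_of_isAxisymmetric_clayForce hν h0A hfA
  by_contra hcon
  refine h ⟨C, ?_⟩
  refine (Filter.not_frequently.1 hcon).mono fun t ht x => ?_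
  by_contra hx
  exact ht ⟨x, not_le.1 hx⟩

/-- **The (C)-reading, instance form**: IF the `ν`-instance of Fefferman's (C) is witnessed by
AXISYMMETRIC data `(u₀, f)`, then `ClayBlowup ν` has an inhabitant which is axisymmetric-generated and
Type II — so any axisymmetric construction aimed at (C) must produce Type-II growth at every singular
point (all on the axis). [cite: FeffermanClay2006, (C)] [cite: KochNadirashviliSereginSverak2009, Thm 6.2] -/
theorem ClayEvolution.exists_clayBlowup_typeII_of_axisymmetric_breakdown {ν : ℝ} (hν : 0 < ν)
    (h : ∃ (u₀ : EuclideanSpace ℝ (Fin 3) → EuclideanSpace ℝ (Fin 3))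
        (f : ℝ → EuclideanSpace ℝ (Fin 3) → EuclideanSpace ℝ (Fin 3)),
        ContDiff ℝ ∞ u₀ ∧ NSWave0.IsDivFree u₀ ∧ HasRapidSpatialDecay u₀ ∧
        IsSmoothOnHalfSpace f ∧ HasRapidSpaceTimeDecay f ∧ IsAxisymmetric u₀ ∧
        (∀ t, 0 ≤ t → IsAxisymmetric (f t)) ∧
          ¬ ∃ (u : ℝ → EuclideanSpace ℝ (Fin 3) → EuclideanSpace ℝ (Fin 3))
              (p : ℝ → EuclideanSpace ℝ (Fin 3) → ℝ),
              IsSmoothOnHalfSpace u ∧ IsSmoothOnHalfSpace p ∧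
                IsNavierStokesSolution ν f u₀ u p ∧ HasBoundedEnergy u) :
    ∃ B : ClayBlowup ν, IsAxisymmetric (B.u 0) ∧ (∀ t ∈ Ico 0 B.T, IsAxisymmetric (B.f t)) ∧
      ¬ IsTypeIBlowup B.u B.T := by
  obtain ⟨u₀, f, hu₀, hdiv, hdec, hs, hd, h0A, hfA, hno⟩ := h
  obtain ⟨B, hB0, hBf, hII, -, -⟩ :=
    ClayEvolution.axisymmetric_breakdown_typeII hν hu₀ hdiv hdec hs hd h0A hfA hno
  exact ⟨B, by rw [hB0]; exact h0A, fun t ht => by rw [hBf]; exact hfA t ht.1, hII⟩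

end Summit.NavierStokesRegularity.FluidComputer

end
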